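import Literature.NumberTheory.Automorphic.DeligneSerreThm46bLeavesProofs
import Literature.NumberTheory.GaloisRepresentations.ArtinEulerFactorSpecProofs
import Literature.NumberTheory.EllipticCurves.Gamma1NewformLSeriesFrickeProofs
import Literature.NumberTheory.Automorphic.ArtinLFunctionsFunctionalEquation
import HarnessLib

/-!
# Deligne–Serre 1974, Thm. 4.6 (b) at `p ∣ N`: the all-pairs form
`Literature.NumberTheory.Automorphic.deligneSerre_eulerPolynomial_eq_of_dvd_level` from the
per-place form (pure proofs; companion to
`Literature.NumberTheory.Automorphic.LanglandsTunnellLSeriesProofs` and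
`Literature.NumberTheory.Automorphic.DeligneSerreThm46bLeavesProofs`)

Source: P. Deligne, J.-P. Serre, *Formes modulaires de poids 1*, Ann. Sci. ÉNS (4) 7 (1974),
Thm. 4.6, p. 514: "Supposons `f` parabolique primitive … Soit `ρ` la représentation de `G`
correspondante.  Alors : (a) Le conducteur d'Artin de `ρ` est égal à `N`; (b) La fonction `L`
d'Artin de `ρ` est égale à `L(s, ρ) = Σ a_n n^{-s}`", with the proof (i)–(iv) of pp. 515–516
("`A = 1` et `F_p = 1` pour tout `p`").

The named fact `deligneSerre_eulerPolynomial_eq_of_dvd_level` (`LanglandsTunnellLSeriesProofs`)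
is statement (b) read off at a prime `p ∣ N` for **every** prime `𝔓` of `\bar ℤ` above `p` and
**every** arithmetic Frobenius `σ` at `𝔓`: `det(1 - T ρ(σ) | V^{I_𝔓}) = 1 - a_p T`.  Its
per-place companion `deligneSerre_eulerFactorAt_eq_of_dvd_level` (the one Euler factor
`L_v(ρ, T) = ArtinRep.eulerFactorAt ρ v` that `L(s, ρ)` sees, computed with a *chosen* pair
`(𝔓, Frob_𝔓)`) is what steps (i)–(iv) of the printed proof deliver, and
`DeligneSerreThm46bLeavesProofs` reduces it to exactly the two functional equations (i)
`DeligneSerre1974.weightOne_functionalEquation` and (ii) `artin_functional_equation (K := ℚ)`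
(`deligneSerre_eulerFactorAt_eq_of_dvd_level_of_functionalEquations''`: Rem. 4.5, 1.8, the Hecke
relations, Lemme 4.9 and steps (iii)–(iv) being theorems of the tree).  This file closes the
remaining gap between the two forms:

* `deligneSerre_eulerPolynomial_eq_of_dvd_level_of_eulerFactorAt`,
  `deligneSerre_eulerPolynomial_eq_of_dvd_level_iff` — the all-pairs form is **equivalent** to
  the per-place form, by the independence of the Euler factor from the choices,
  `ArtinRep.eulerFactorAt_spec_holds`
  (`Literature.NumberTheory.GaloisRepresentations.ArtinEulerFactorSpecProofs`, proved: primes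
  above `p` are conjugate, Frobenii form an `I_𝔓`-coset acting trivially on `V^{I_𝔓}`; Neukirch,
  *Algebraic Number Theory*, VII §10, before (10.2)).
* `deligneSerre_eulerPolynomial_eq_of_dvd_level_of_functionalEquations` — the named fact from
  (i) and (ii) alone.
* `deligneSerre_eulerFactorAt_eq_of_dvd_level_of_artin_functional_equation`,
  `deligneSerre_eulerPolynomial_eq_of_dvd_level_of_artin_functional_equation`,
  `artinLFunction_eq_cuspFormLSeries_of_artin_functional_equation` — **Thm. 4.6 (b) (per-place
  form, all-pairs form, and `L(s, ρ) = Σ aₙ n^{-s}` on `re s > 1`) from Artin's functional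
  equation (ii) alone**: input (i) is now the theorem
  `DeligneSerre1974.weightOne_functionalEquation_holds` of
  `Literature.NumberTheory.EllipticCurves.Gamma1NewformLSeriesFrickeProofs` (the
  `W_N`-pseudo-eigenvalue theorem `f ∣ w_N = c f̃` for newforms on `Γ₁(N)` and Hecke's Mellin
  argument, both proved there and in `Gamma1FrickeFunctionalEquationProofs`).  So
  `theorem deligneSerre_eulerPolynomial_eq_of_dvd_level_holds` is
  `deligneSerre_eulerPolynomial_eq_of_dvd_level_of_artin_functional_equation artin_functional_equation_holds`
  once Artin's functional equation over `ℚ` (Artin–Brauer–Hecke; decomposed in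
  `Literature.NumberTheory.Automorphic.ArtinLFunctionsFunctionalEquation`) is in the tree.
* `deligneSerre_eulerPolynomial_eq_of_dvd_level_of_pair` — the single-pair form: for one
  newform `f` and one `ρ` attached to it, Artin's functional equation **of `ρ`**
  (`ArtinRep.SatisfiesFunctionalEquation ρ ρ^∨`) alone gives the local statement at every
  `p ∣ N`, all primes above `p`, all Frobenii.

* `deligneSerre_eulerFactorAt_eq_of_dvd_level_of_brauer_of_rankOne`,
  `deligneSerre_eulerPolynomial_eq_of_dvd_level_of_brauer_of_rankOne`,
  `artinLFunction_eq_cuspFormLSeries_of_brauer_of_rankOne` — the same three statements **from the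
  current leaves of (ii)** in the tree's decomposition of Artin's functional equation
  (`Literature.NumberTheory.Automorphic.ArtinLFunctionsFunctionalEquation`; Neukirch, *Algebraic
  Number Theory*, VII, proof of (12.6)): Brauer's factorisation of the completed Artin
  `L`-functions over `ℚ` (`brauer_completedArtinLFunction_eq_prod_zpow (K := ℚ)`) and the
  functional equation for characters of degree one over every number field
  (`artin_functional_equation_rankOne`), assembled by the proved
  `artin_functional_equation_of_brauer_of_rankOne` — the companion for (b) of
  `thm46a_of_brauer_of_rankOne` (`DeligneSerreThm46aLeavesProofs`).

No definition, no new named fact, nothing restated.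

## References

* P. Deligne, J.-P. Serre, *Formes modulaires de poids 1*, Ann. Sci. ÉNS (4) 7 (1974),
  507–530, doi:10.24033/asens.1277 — Thm. 4.6 (p. 514) and its proof (i)–(iv) (pp. 515–516)
  (`DeligneSerreASENS1974`).
* J. Neukirch, *Algebraic Number Theory*, Grundlehren 322 (1999), Ch. VII §10 (independence of
  the Euler factor from the choices) and the proof of (12.6), pp. 537–538 (Brauer's reduction of
  Artin's functional equation to characters of degree one) (`NeukirchANT1999`).
-/

noncomputable section

open scoped MatrixGroups ModularForm NumberField

open CongruenceSubgroup IsDedekindDomain Polynomial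

namespace Literature.NumberTheory.Automorphic

open EllipticCurves.ModularForms ModularForms Rat.HeightOneSpectrum

/-! ### All pairs `(𝔓, Frob_𝔓)` versus the chosen pair -/

/-- **The all-pairs form of Thm. 4.6 (b) at `p ∣ N` from the per-place form.**  If for every
newform `f ∈ S_1(Γ₁(N))`, every `ρ` attached to it and every place `v ∣ N` the Euler factor
`L_v(ρ, T)` (`ArtinRep.eulerFactorAt`, computed with the pair `(𝔓, Frob_𝔓)` chosen there) is
`1 - a_p T`, then the Euler polynomial `det(1 - T ρ(σ) | V^{I_𝔓})` is `1 - a_p T` for **every**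
prime `𝔓 ∣ p` of `\bar ℤ` and **every** arithmetic Frobenius `σ` at `𝔓`: the Euler factor does
not depend on the choices (`ArtinRep.eulerFactorAt_spec_holds`; Neukirch, *Algebraic Number
Theory*, VII §10, before (10.2)). [cite: DeligneSerreASENS1974, Thm. 4.6 (b)]
[cite: NeukirchANT1999, VII §10, before (10.2)] -/
theorem deligneSerre_eulerPolynomial_eq_of_dvd_level_of_eulerFactorAt
    (hloc : deligneSerre_eulerFactorAt_eq_of_dvd_level) :
    deligneSerre_eulerPolynomial_eq_of_dvd_level := by
  intro N _ f ρ hf hρ v hv 𝔓 h𝔓 σ hσ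
  rw [← GaloisRepresentations.ArtinRep.eulerFactorAt_spec_holds ρ.toArtinRep h𝔓 hσ]
  exact hloc hf hρ hv

/-- The all-pairs and the per-place forms of Deligne–Serre 1974, Thm. 4.6 (b) at `p ∣ N` are
equivalent (`deligneSerre_eulerFactorAt_eq_of_dvd_level_of`,
`deligneSerre_eulerPolynomial_eq_of_dvd_level_of_eulerFactorAt`).
[cite: DeligneSerreASENS1974, Thm. 4.6 (b)] -/
theorem deligneSerre_eulerPolynomial_eq_of_dvd_level_iff :
    deligneSerre_eulerPolynomial_eq_of_dvd_level ↔ deligneSerre_eulerFactorAt_eq_of_dvd_level :=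
  ⟨deligneSerre_eulerFactorAt_eq_of_dvd_level_of,
    deligneSerre_eulerPolynomial_eq_of_dvd_level_of_eulerFactorAt⟩

/-! ### The named fact from the two functional equations (i), (ii) -/

/-- **Deligne–Serre 1974, Thm. 4.6 (b) at the primes dividing the level, all-pairs form (the
named fact `deligneSerre_eulerPolynomial_eq_of_dvd_level`), from the two functional equations
alone**: (i) `DeligneSerre1974.weightOne_functionalEquation` (all levels; Hecke–Li) and
(ii) `artin_functional_equation (K := ℚ)` (Artin–Brauer).  Composition of
`deligneSerre_eulerFactorAt_eq_of_dvd_level_of_functionalEquations''` (steps (iii)–(iv),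
Lemme 4.9, the Hecke relations, Rem. 4.5 and 1.8 all proved) with the independence of the
choices (`deligneSerre_eulerPolynomial_eq_of_dvd_level_of_eulerFactorAt`).  When (i) and (ii)
are discharged, `deligneSerre_eulerPolynomial_eq_of_dvd_level_holds` is this theorem applied to
their `_holds` versions. [cite: DeligneSerreASENS1974, Thm. 4.6 (b) and its proof, (i)–(iv)] -/
theorem deligneSerre_eulerPolynomial_eq_of_dvd_level_of_functionalEquations
    (hFEf : ∀ {N : ℕ} [NeZero N], DeligneSerre1974.weightOne_functionalEquation (N := N))
    (hFEρ : artin_functional_equation (K := ℚ)) :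
    deligneSerre_eulerPolynomial_eq_of_dvd_level :=
  deligneSerre_eulerPolynomial_eq_of_dvd_level_of_eulerFactorAt
    (deligneSerre_eulerFactorAt_eq_of_dvd_level_of_functionalEquations'' hFEf hFEρ)

/-! ### Thm. 4.6 (b) from Artin's functional equation (ii) alone -/

/-- **Deligne–Serre 1974, Thm. 4.6 (b) at `p ∣ N`, per-place form, from Artin's functional
equation over `ℚ` alone.**  Input (i) of `deligneSerre_eulerFactorAt_eq_of_dvd_level_of_functionalEquations''`,
the weight-one functional equation `Λ_f(1 - s) = a Λ_{f̃}(s)` of a newform on `Γ₁(N)`, is the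
theorem `DeligneSerre1974.weightOne_functionalEquation_holds` (`Gamma1NewformLSeriesFrickeProofs`:
`f ∣ w_N = c f̃` by multiplicity one on `Γ₁(N)`, then Hecke's Mellin transform); what remains is
(ii), `artin_functional_equation (K := ℚ)` (Artin 1931, Brauer 1947).
[cite: DeligneSerreASENS1974, Thm. 4.6 (b) and its proof, (i)–(iv)] -/
theorem deligneSerre_eulerFactorAt_eq_of_dvd_level_of_artin_functional_equation
    (hFEρ : artin_functional_equation (K := ℚ)) :
    deligneSerre_eulerFactorAt_eq_of_dvd_level :=
  deligneSerre_eulerFactorAt_eq_of_dvd_level_of_functionalEquations''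
    (fun {_} _ ↦ DeligneSerre1974.weightOne_functionalEquation_holds) hFEρ

/-- **Deligne–Serre 1974, Thm. 4.6 (b) at `p ∣ N`, all-pairs form (the named fact
`deligneSerre_eulerPolynomial_eq_of_dvd_level`), from Artin's functional equation over `ℚ`
alone** (`deligneSerre_eulerFactorAt_eq_of_dvd_level_of_artin_functional_equation` and the
independence of the choices).  Once `artin_functional_equation (K := ℚ)` is discharged,
`deligneSerre_eulerPolynomial_eq_of_dvd_level_holds` is this theorem applied to its `_holds`
version. [cite: DeligneSerreASENS1974, Thm. 4.6 (b) and its proof, (i)–(iv)] -/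
theorem deligneSerre_eulerPolynomial_eq_of_dvd_level_of_artin_functional_equation
    (hFEρ : artin_functional_equation (K := ℚ)) :
    deligneSerre_eulerPolynomial_eq_of_dvd_level :=
  deligneSerre_eulerPolynomial_eq_of_dvd_level_of_eulerFactorAt
    (deligneSerre_eulerFactorAt_eq_of_dvd_level_of_artin_functional_equation hFEρ)

/-- **Thm. 4.6 (b), `L(s, ρ) = Σ aₙ n^{-s}` on `re s > 1`** (the named fact
`artinLFunction_eq_cuspFormLSeries` of `LanglandsTunnell`, for a weight-one newform `f` and a
representation `ρ` attached to it) **from Artin's functional equation over `ℚ` alone**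
(`artinLFunction_eq_cuspFormLSeries_of_hecke'` with
`deligneSerre_eulerFactorAt_eq_of_dvd_level_of_artin_functional_equation`).
[cite: DeligneSerreASENS1974, Thm. 4.6 (b)] -/
theorem artinLFunction_eq_cuspFormLSeries_of_artin_functional_equation
    (hFEρ : artin_functional_equation (K := ℚ))
    {N : ℕ} [NeZero N] {f : CuspForm (Gamma1 N) 1} {ρ : GaloisRepresentations.FramedArtinRep ℚ 2} :
    artinLFunction_eq_cuspFormLSeries (f := f) (ρ := ρ) :=
  artinLFunction_eq_cuspFormLSeries_of_hecke'
    (deligneSerre_eulerFactorAt_eq_of_dvd_level_of_artin_functional_equation hFEρ)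

/-! ### One pair `(f, ρ)`: Artin's functional equation of `ρ` suffices -/

/-- **Thm. 4.6 (b) at `p ∣ N` for one pair, all primes above `p` and all Frobenii, from Artin's
functional equation of that `ρ`.**  Let `f ∈ S_1(Γ₁(N))` be a newform and
`ρ : Γ_ℚ → GL₂(ℂ)` a continuous representation attached to `f` away from `N` satisfying Artin's
functional equation `Λ(1 - s, ρ) = W Λ(s, ρ^∨)` (`ArtinRep.SatisfiesFunctionalEquation`,
`ρ^∨ = FramedRep.dual ρ`).  Then for every `p ∣ N`, every prime `𝔓` of `\bar ℤ` above `p` and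
every arithmetic Frobenius `σ` at `𝔓`, `det(1 - T ρ(σ) | V^{I_𝔓}) = 1 - a_p T`.  Steps
(iii)–(iv) are `eulerFactorAt_eq_of_dvd_level_of_functionalEquations`; the functional equation
(i) of `f` is `DeligneSerre1974.weightOne_functionalEquation_holds hf`, oddness of `ρ` is
`DeligneSerre1974.rem45_isOdd_holds` (`ρ` has finite image, `finite_range_framed`), `|a_p| ≤ 1`
is 1.8 (`IsNewform1.cuspCoeff_of_dvd_level_holds`), the Hecke relations are Part D of
`LanglandsTunnellLSeriesProofs`, and the passage to all pairs is
`ArtinRep.eulerFactorAt_spec_holds`. [cite: DeligneSerreASENS1974, Thm. 4.6 (b) and its proof, (i)–(iv)] -/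
theorem deligneSerre_eulerPolynomial_eq_of_dvd_level_of_pair {N : ℕ} [NeZero N]
    {f : CuspForm (Gamma1 N) 1} {ρ : GaloisRepresentations.FramedArtinRep ℚ 2} (hf : IsNewform1 f)
    (hρ : IsGaloisRepOfNewform1 f (algebraMap (coeffCharField f) ℂ) {p | p ∣ N} ρ)
    (hFEρ : GaloisRepresentations.ArtinRep.SatisfiesFunctionalEquation ρ.toArtinRep
      (GaloisRepresentations.FramedArtinRep.toArtinRep (GaloisRepresentations.FramedRep.dual ρ)))
    {v : HeightOneSpectrum (𝓞 ℚ)} (hv : ((primesEquiv v : Nat.Primes) : ℕ) ∣ N)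
    {𝔓 : Ideal (GaloisRepresentations.absIntegers (𝓞 ℚ) ℚ)} (h𝔓 : 𝔓 ∈ v.primesAbove)
    {σ : Field.absoluteGaloisGroup ℚ} (hσ : IsArithFrobAt (𝓞 ℚ) σ 𝔓) :
    ρ.toArtinRep.eulerPolynomial 𝔓 ⟨σ, by haveI := h𝔓.1; exact hσ.mem_stabilizer⟩ =
      1 - C (cuspCoeff f (primesEquiv v : Nat.Primes)) * X := by
  rw [← GaloisRepresentations.ArtinRep.eulerFactorAt_spec_holds ρ.toArtinRep h𝔓 hσ]
  exact eulerFactorAt_eq_of_dvd_level_of_functionalEquations hf hρ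
    (DeligneSerre1974.rem45_isOdd_holds hf ρ hρ (finite_range_framed ρ))
    (IsNewform1.cuspCoeff_mul_of_coprime_holds hf)
    (IsNewform1.cuspCoeff_prime_pow_add_two_holds.weight_one hf)
    (fun hp hpN ↦ IsNewform1.norm_cuspCoeff_le_one_of_dvd_level
      IsNewform1.cuspCoeff_of_dvd_level_holds hf hp hpN)
    (DeligneSerre1974.weightOne_functionalEquation_holds hf) hFEρ hv


/-! ### From the current leaves of (ii): Brauer's factorisation and the degree-one case -/

/-- **Deligne–Serre 1974, Thm. 4.6 (b) at `p ∣ N`, per-place form, from the current leaves of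
Artin's functional equation** (Neukirch, *Algebraic Number Theory*, VII, proof of (12.6)):
Brauer's factorisation of the completed Artin `L`-functions over `ℚ`
(`brauer_completedArtinLFunction_eq_prod_zpow (K := ℚ)`) and the functional equation for
characters of degree one over every number field (`artin_functional_equation_rankOne`), assembled
into (ii) by the proved `artin_functional_equation_of_brauer_of_rankOne` and fed to
`deligneSerre_eulerFactorAt_eq_of_dvd_level_of_artin_functional_equation`.
[cite: DeligneSerreASENS1974, Thm. 4.6 (b) and its proof, (i)–(iv)]
[cite: NeukirchANT1999, VII (12.6) proof] -/
theorem deligneSerre_eulerFactorAt_eq_of_dvd_level_of_brauer_of_rankOne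
    (hA : brauer_completedArtinLFunction_eq_prod_zpow (K := ℚ))
    (hB : ∀ (M : Type) [Field M] [NumberField M], artin_functional_equation_rankOne (K := M)) :
    deligneSerre_eulerFactorAt_eq_of_dvd_level :=
  deligneSerre_eulerFactorAt_eq_of_dvd_level_of_artin_functional_equation
    (artin_functional_equation_of_brauer_of_rankOne hA hB)

/-- **Deligne–Serre 1974, Thm. 4.6 (b) at `p ∣ N`, all-pairs form (the named fact
`deligneSerre_eulerPolynomial_eq_of_dvd_level`), from the current leaves of Artin's functional
equation** (`brauer_completedArtinLFunction_eq_prod_zpow (K := ℚ)` and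
`artin_functional_equation_rankOne` over every number field, via
`artin_functional_equation_of_brauer_of_rankOne`).  Once both leaves are discharged,
`deligneSerre_eulerPolynomial_eq_of_dvd_level_holds` is this theorem applied to their `_holds`
versions (equivalently `deligneSerre_eulerPolynomial_eq_of_dvd_level_of_artin_functional_equation
artin_functional_equation_holds`). [cite: DeligneSerreASENS1974, Thm. 4.6 (b) and its proof, (i)–(iv)]
[cite: NeukirchANT1999, VII (12.6) proof] -/
theorem deligneSerre_eulerPolynomial_eq_of_dvd_level_of_brauer_of_rankOne
    (hA : brauer_completedArtinLFunction_eq_prod_zpow (K := ℚ))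
    (hB : ∀ (M : Type) [Field M] [NumberField M], artin_functional_equation_rankOne (K := M)) :
    deligneSerre_eulerPolynomial_eq_of_dvd_level :=
  deligneSerre_eulerPolynomial_eq_of_dvd_level_of_artin_functional_equation
    (artin_functional_equation_of_brauer_of_rankOne hA hB)

/-- **Thm. 4.6 (b), `L(s, ρ) = Σ aₙ n^{-s}` on `re s > 1`, from the current leaves of Artin's
functional equation** (`artinLFunction_eq_cuspFormLSeries_of_artin_functional_equation` with
`artin_functional_equation_of_brauer_of_rankOne`). [cite: DeligneSerreASENS1974, Thm. 4.6 (b)]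
[cite: NeukirchANT1999, VII (12.6) proof] -/
theorem artinLFunction_eq_cuspFormLSeries_of_brauer_of_rankOne
    (hA : brauer_completedArtinLFunction_eq_prod_zpow (K := ℚ))
    (hB : ∀ (M : Type) [Field M] [NumberField M], artin_functional_equation_rankOne (K := M))
    {N : ℕ} [NeZero N] {f : CuspForm (Gamma1 N) 1} {ρ : GaloisRepresentations.FramedArtinRep ℚ 2} :
    artinLFunction_eq_cuspFormLSeries (f := f) (ρ := ρ) :=
  artinLFunction_eq_cuspFormLSeries_of_artin_functional_equation
    (artin_functional_equation_of_brauer_of_rankOne hA hB)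

end Literature.NumberTheory.Automorphic

end
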